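import Summits.BirchSwinnertonDyer.BirchSwinnertonDyer.Theses.TwistFamilyManinDescent
import Literature.NumberTheory.EllipticCurves.QuadraticTwistKroneckerLFunctionProofs
import Literature.NumberTheory.EllipticCurves.PAdicLFunctionQuadraticTwistBirchSharedPrimesProofs
import Literature.NumberTheory.EllipticCurves.RootNumberTwistSemistableProofs
import Literature.NumberTheory.EllipticCurves.QuadraticTwistJInvariantProofs
import HarnessLib

/-!
# Route `TwistFamilyManinDescent` — crux `TwistFamilyDescent` (stmt-BirchSwinnertonDyer-25136, rank 2):
# WHOLE-FAMILY DESCENT of the class Manin certificate along twists coprime to 2·A·d₀, closed by name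

HONEST FRAMING. The item is CONDITIONAL on modularity (`exists_isNewformOf`, its first binder) and proves nothing
about Manin's conjecture by itself: it says that the class predicate `ClassAbsManinConstantEqOne` (|c| = 1 at every
lattice-optimal `X₀`-datum of every globally minimal member of the isogeny class) PROPAGATES from the two base
twists `E₀ ⊗ d₀`, `E₀ ⊗ (−d₀)` to every twist `E₀ ⊗ (d₀ d₁)` with `d₁` coprime to `2·A·d₀`, `A` a multiple of every
odd additive prime of `E₀`. BSD is not proved by this; Manin's conjecture is not proved by this.

PROOF (the planner's plan, bsd-idea-3 g4, executed). Strong induction on `|d₁|`, simultaneously for both signs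
`e₀ ∈ {d₀, −d₀}`. `|d₁| = 1`: the two hypotheses. `|d₁| > 1`: let `q` be a prime factor of `d₁`; by coprimality
`q` is odd, `q ∤ A` (so `E₀` is good or multiplicative at `q`), `q ∤ d₀`.
* If `q² ∣ d₁`, `E₀ ⊗ (e₀ d₁) ≅ E₀ ⊗ (e₀ d₁/q²)` (`exists_variableChange_quadraticTwist_mul_sq`) and the predicate is a
  class invariant (`ClassAbsManinConstantEqOne.of_isIsogenous`): induction.
* If `q ∥ d₁`, `W = E₀ ⊗ (e₀ d₁)` is ADDITIVE at `q` (§1: a twist ramified at an odd prime of semistable reduction,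
  tree `hasAdditiveReductionAt_quadraticTwist_of_dvd` / `…_of_hasMultiplicativeReductionAt` on a global minimal model of
  `E₀`, transported by `quadraticTwist_smul`), so `q² ∣ N(W)`; and `W ⊗ χ_{q*} = E₀ ⊗ (e₀ d₁ q*) ≅ E₀ ⊗ (±e₀ d₁/q)`
  (`quadraticTwist_quadraticTwist`, square removal) is good or multiplicative at `q` (§1: unit twist,
  `hasReductionAt_quadraticTwist_iff_of_not_dvd`) and satisfies the predicate by induction (the sign `±` from
  `q* = ±q` lands on `±d₀` — this is why both base twists are hypotheses); the cell's ONE-STEP descent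
  `classAbsManinConstantEqOne_of_quadraticTwist_pStar` (Stevens (5.2)+(5.4) on `Γ₀`, PROVED in the tree modulo
  modularity) concludes.

References: [Stevens1989] Lemmas (5.2), (5.4); [AgasheRibetStein2006] §2; [SilvermanAEC2009] VII.1 Rem. 1.1,
VII.5 Prop. 5.1, X.5 Cor. 5.4.
-/

-- D-0017: single-problem summit, so `Summit.BirchSwinnertonDyer.BirchSwinnertonDyer.…` repeats a namespace BY DESIGN.
set_option linter.dupNamespace false
set_option autoImplicit false

noncomputable section

open scoped Classical NumberField

open WeierstrassCurve IsDedekindDomain Rat.HeightOneSpectrum NumberField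
  Literature.NumberTheory.EllipticCurves Literature.NumberTheory.EllipticCurves.ModularForms
  Literature.NumberTheory.EllipticCurves.Rank1Residual
  Summit.BirchSwinnertonDyer.BirchSwinnertonDyer.Theses.TwistFamilyManinDescent

namespace Summit.BirchSwinnertonDyer.BirchSwinnertonDyer.Theorems.TwistFamilyManinDescent

/-! ### §1 Reduction types of quadratic twists at an odd prime (any model of the curve) -/

/-- **A twist ramified at an odd prime of semistable reduction is additive there** (any model): if `E₀/ℚ` is good
or multiplicative at the odd prime `q` (`¬ Addv E₀ q`) and `q ∥ D`, then `E₀ ⊗ D` is additive at `q`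
(`Addv (E₀ ⊗ D) q`). On a global minimal model `M` of `E₀` this is the tree's
`hasAdditiveReductionAt_quadraticTwist_of_dvd` (good) / `…_of_hasMultiplicativeReductionAt` (multiplicative);
`M ⊗ D ≅ E₀ ⊗ D` by `quadraticTwist_smul`, and reduction types are isomorphism invariants.
[cite: SilvermanAEC2009, VII.1 Remark 1.1 and VII.5 Prop. 5.1(c)] -/
theorem addv_quadraticTwist_of_dvd_of_not_sq_dvd (E₀ : WeierstrassCurve ℚ) [E₀.IsElliptic]
    (q : ℕ) [hqF : Fact q.Prime] (hq2 : q ≠ 2) (hE : ¬ Addv E₀ q) {D : ℤ} (hD0 : D ≠ 0)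
    (h1 : (q : ℤ) ∣ D) (h2 : ¬ (q : ℤ) ^ 2 ∣ D) : Addv (E₀.quadraticTwist (D : ℚ)) q := by
  have hq : q.Prime := hqF.out
  -- the place of `𝓞 ℚ` over `q`
  set v : HeightOneSpectrum (𝓞 ℚ) := (primesEquiv (R := 𝓞 ℚ)).symm ⟨q, hq⟩ with hv
  have hvq : (primesEquiv v : Nat.Primes) = ⟨q, hq⟩ := by rw [hv, Equiv.apply_symm_apply]
  have hvq' : (primesEquiv v : ℕ) = q := by rw [hvq]
  have hDq : (D : ℚ) ≠ 0 := by exact_mod_cast hD0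
  haveI := E₀.isElliptic_quadraticTwist hDq
  -- a global minimal model `M = C₀ • E₀`
  obtain ⟨C₀, hM⟩ := hasGlobalMinimalModel_rat_holds E₀
  haveI : (C₀ • E₀).IsGloballyMinimal := hM
  -- `M` is good or multiplicative at `v`
  have hgm : (C₀ • E₀).HasGoodReductionAt v ∨ (C₀ • E₀).HasMultiplicativeReductionAt v := by
    by_contra h
    simp only [not_or] at h
    refine hE ⟨fun hg ↦ h.1 ?_, fun hm ↦ h.2 ?_⟩
    · refine (hasGoodReductionAt_smul_iff_holds v E₀ C₀).mpr ?_
      have hg' := (hasGoodReductionAtPrime_iff_hasGoodReductionAt_ringOfIntegers v E₀)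
      rw [hvq] at hg'
      exact hg'.mp hg
    · refine (hasMultiplicativeReductionAt_smul_iff_holds v E₀ C₀).mpr ?_
      have hm' := (hasMultiplicativeReductionAtPrime_iff_hasMultiplicativeReductionAt_ringOfIntegers E₀ v)
      rw [hvq] at hm'
      exact hm'.mp hm
  -- the twist of `M` is additive at `v`
  have h1' : ((primesEquiv v : ℕ) : ℤ) ∣ D := by rw [hvq']; exact h1
  have h2' : ¬ ((primesEquiv v : ℕ) : ℤ) ^ 2 ∣ D := by rw [hvq']; exact h2
  have hv2 : (primesEquiv v : ℕ) ≠ 2 := by rw [hvq']; exact hq2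
  have hadd : ((C₀ • E₀).quadraticTwist (D : ℚ)).HasAdditiveReductionAt v := by
    rcases hgm with hg | hm
    · exact hasAdditiveReductionAt_quadraticTwist_of_dvd (C₀ • E₀) v hv2 hD0 h1' h2' hg
    · exact hasAdditiveReductionAt_quadraticTwist_of_dvd_of_hasMultiplicativeReductionAt (C₀ • E₀) v hv2 hD0
        h1' h2' hm
  -- `M ⊗ D = C' • (E₀ ⊗ D)`
  rw [quadraticTwist_smul] at hadd
  have hng : ¬ (E₀.quadraticTwist (D : ℚ)).HasGoodReductionAt v := fun h ↦
    hadd.not_hasGoodReductionAt ((hasGoodReductionAt_smul_iff_holds v _ _).mpr h)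
  have hnm : ¬ (E₀.quadraticTwist (D : ℚ)).HasMultiplicativeReductionAt v := fun h ↦
    hadd.not_hasMultiplicativeReductionAt ((hasMultiplicativeReductionAt_smul_iff_holds v _ _).mpr h)
  refine ⟨fun hg ↦ hng ?_, fun hm ↦ hnm ?_⟩
  · have hg' := (hasGoodReductionAtPrime_iff_hasGoodReductionAt_ringOfIntegers v (E₀.quadraticTwist (D : ℚ)))
    rw [hvq] at hg'
    exact hg'.mp hg
  · have hm' := (hasMultiplicativeReductionAtPrime_iff_hasMultiplicativeReductionAt_ringOfIntegers
      (E₀.quadraticTwist (D : ℚ)) v)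
    rw [hvq] at hm'
    exact hm'.mp hm

/-- **A twist UNRAMIFIED at an odd prime of semistable reduction stays semistable there, on any isomorphic model**:
if `E₀/ℚ` is good or multiplicative at the odd prime `q`, `q ∤ D`, and `C • (E₀ ⊗ D) = V`, then `V` is good or
multiplicative at the place of `ℤ` over `q` (tree `hasReductionAt_quadraticTwist_iff_of_not_dvd`; isomorphism
invariance of the reduction type). [cite: SilvermanAEC2009, VII.5 Prop. 5.1 and VII.1 Prop. 1.3(b)] -/
theorem good_or_mult_of_smul_quadraticTwist_of_not_dvd (E₀ : WeierstrassCurve ℚ) [E₀.IsElliptic]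
    {q : ℕ} (hq : q.Prime) (hq2 : q ≠ 2) (hE : haveI := Fact.mk hq; ¬ Addv E₀ q) {D : ℤ} (hD : ¬ (q : ℤ) ∣ D)
    {V : WeierstrassCurve ℚ} {C : VariableChange ℚ} (hC : C • E₀.quadraticTwist (D : ℚ) = V) :
    V.HasGoodReductionAt ((primesEquiv (R := ℤ)).symm ⟨q, hq⟩) ∨
      V.HasMultiplicativeReductionAt ((primesEquiv (R := ℤ)).symm ⟨q, hq⟩) := by
  haveI := Fact.mk hq
  set v : HeightOneSpectrum ℤ := (primesEquiv (R := ℤ)).symm ⟨q, hq⟩ with hv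
  have hgen : natGenerator v = q := congrArg Subtype.val ((primesEquiv (R := ℤ)).apply_symm_apply ⟨q, hq⟩)
  have hD0 : D ≠ 0 := fun h ↦ hD (by rw [h]; exact dvd_zero _)
  have hDq : (D : ℚ) ≠ 0 := by exact_mod_cast hD0
  haveI := E₀.isElliptic_quadraticTwist hDq
  obtain ⟨hg, hm, -⟩ := hasReductionAt_quadraticTwist_iff_of_not_dvd E₀ v (by rw [hgen]; exact hq2)
    (d := D) (by rw [hgen]; exact hD)
  -- `E₀` is good or multiplicative at `v`
  have hE' : E₀.HasGoodReductionAt v ∨ E₀.HasMultiplicativeReductionAt v := by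
    by_contra h
    simp only [not_or] at h
    exact hE ⟨fun hg' ↦ h.1 ((E₀.hasGoodReductionAtPrime_iff_hasGoodReductionAt_holds ⟨q, hq⟩).mp hg'),
      fun hm' ↦ h.2 ((E₀.hasMultiplicativeReductionAtPrime_iff_hasMultiplicativeReductionAt_holds ⟨q, hq⟩).mp hm')⟩
  rw [← hC]
  rcases hE' with h | h
  · exact Or.inl ((hasGoodReductionAt_smul_iff_holds v _ C).mpr (hg.mpr h))
  · exact Or.inr ((hasMultiplicativeReductionAt_smul_iff_holds v _ C).mpr (hm.mpr h))

/-! ### §2 The whole-family descent -/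

/-- **Item stmt-BirchSwinnertonDyer-25136 by name: WHOLE-FAMILY DESCENT.** Granted modularity (`exists_isNewformOf`):
for `E₀/ℚ` elliptic, `A ∈ ℕ` divisible by every odd additive prime of `E₀`, `d₀, d₁ ≠ 0` with `d₁` coprime to
`2·A·d₀`: if the classes of `E₀ ⊗ d₀` and `E₀ ⊗ (−d₀)` satisfy the class Manin certificate
`ClassAbsManinConstantEqOne`, so does the class of `E₀ ⊗ (d₀ d₁)`. Strong induction on `|d₁|` for both signs at
once; a square prime factor of `d₁` is removed by a change of variables, a simple odd prime factor `q` by the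
cell's one-step descent `classAbsManinConstantEqOne_of_quadraticTwist_pStar` (twist by `q* = ±q`: the target is
additive at `q`, the partner `E₀ ⊗ (±d₀ d₁/q)` semistable at `q` and certified by induction).
[cite: Stevens1989, Lemmas (5.2), (5.4)] [cite: AgasheRibetStein2006, §2]
[cite: SilvermanAEC2009, VII.5 Prop. 5.1 and X.5 Cor. 5.4] -/
theorem twistFamilyDescent_proof : TwistFamilyDescent := by
  unfold TwistFamilyDescent
  intro hnf E₀ _ A hA d₀ d₁ hd₀ hd₁ hcop hplus hminus
  -- strong induction on `|d|`, both signs `e₀ ∈ {d₀, −d₀}` at once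
  suffices key : ∀ (n : ℕ) (d : ℤ), d ≠ 0 → d.natAbs < n → IsCoprime d (2 * A * d₀) →
      ∀ e₀ : ℤ, (e₀ = d₀ ∨ e₀ = -d₀) → ClassAbsManinConstantEqOne (E₀.quadraticTwist ((e₀ * d : ℤ) : ℚ)) from
    key _ d₁ hd₁ (Nat.lt_succ_self _) hcop d₀ (Or.inl rfl)
  intro n
  induction n with
  | zero => intro d _ hd; exact absurd hd (Nat.not_lt_zero _)
  | succ n ih =>
    intro d hd0 hdn hcop e₀ he₀
    have he₀0 : e₀ ≠ 0 := by rcases he₀ with rfl | rfl <;> simp [hd₀]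
    by_cases h1 : d.natAbs = 1
    · -- `d = ±1`: the two base twists
      have hprod : e₀ * d = d₀ ∨ e₀ * d = -d₀ := by
        rcases Int.natAbs_eq_iff.mp h1 with hd | hd <;> rcases he₀ with he | he
        · left; rw [hd, he]; simp
        · right; rw [hd, he]; simp
        · right; rw [hd, he]; simp
        · left; rw [hd, he]; simp
      rcases hprod with h | h
      · rw [h]; exact hplus
      · rw [h]; exact hminus
    -- a prime factor `q` of `d`
    have hd1 : d.natAbs ≠ 1 := h1
    set q : ℕ := d.natAbs.minFac with hqdef
    have hq : q.Prime := Nat.minFac_prime hd1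
    haveI := Fact.mk hq
    have hqZ : Prime (q : ℤ) := Nat.prime_iff_prime_int.mp hq
    have hqd : (q : ℤ) ∣ d := Int.ofNat_dvd_left.mpr (Nat.minFac_dvd _)
    have hq0 : (q : ℚ) ≠ 0 := by exact_mod_cast hq.ne_zero
    -- coprimality: `q ∤ 2·A·d₀`
    have hnot : ¬ (q : ℤ) ∣ 2 * A * d₀ := fun h ↦ by
      have hu := hcop.isUnit_of_dvd' hqd h
      rw [Int.isUnit_iff_natAbs_eq, Int.natAbs_natCast] at hu
      exact hq.one_lt.ne' hu
    have hq2 : q ≠ 2 := by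
      rintro hq2
      exact hnot ⟨A * d₀, by rw [hq2]; push_cast; ring⟩
    have hqA : ¬ q ∣ A := by
      rintro ⟨k, hk⟩
      exact hnot ⟨2 * k * d₀, by rw [hk]; push_cast; ring⟩
    have hqe₀ : ¬ (q : ℤ) ∣ e₀ := by
      have hqd₀ : ¬ (q : ℤ) ∣ d₀ := by
        rintro ⟨k, hk⟩
        exact hnot ⟨2 * A * k, by rw [hk]; ring⟩
      rcases he₀ with rfl | rfl
      · exact hqd₀
      · rwa [dvd_neg]
    -- `E₀` is good or multiplicative at `q`
    have hE : ¬ Addv E₀ q := fun h ↦ hqA (hA q hq2 h)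
    by_cases hsq : (q : ℤ) ^ 2 ∣ d
    · -- `q² ∣ d`: remove the square by a change of variables
      obtain ⟨d', hd'⟩ := hsq
      have hd'0 : d' ≠ 0 := by rintro rfl; exact hd0 (by rw [hd', mul_zero])
      have hlt : d'.natAbs < n := by
        have h2q : 2 ≤ q := hq.two_le
        have hab : d.natAbs = q ^ 2 * d'.natAbs := by rw [hd', Int.natAbs_mul, Int.natAbs_pow, Int.natAbs_natCast]
        have hpos : 0 < d'.natAbs := Int.natAbs_pos.mpr hd'0
        have h1q : 1 < q ^ 2 := by nlinarith
        have : d'.natAbs < d.natAbs := by rw [hab]; exact lt_mul_of_one_lt_left hpos h1q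
        omega
      have hcop' : IsCoprime d' (2 * A * d₀) := by
        rw [hd'] at hcop
        exact hcop.of_mul_left_right
      have ih' := ih d' hd'0 hlt hcop' e₀ he₀
      obtain ⟨C, hC⟩ := exists_variableChange_quadraticTwist_mul_sq E₀ ((e₀ * d' : ℤ) : ℚ) (q : ℚ) hq0
      have hcast : ((e₀ * d : ℤ) : ℚ) = ((e₀ * d' : ℤ) : ℚ) * (q : ℚ) ^ 2 := by rw [hd']; push_cast; ring
      rw [hcast, ← hC]
      exact ih'.of_isIsogenous (isIsogenous_smul _ C)
    · -- `q ∥ d`: the one-step descent along `χ_{q*}`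
      obtain ⟨d', hd'⟩ := hqd
      have hd'0 : d' ≠ 0 := by rintro rfl; exact hd0 (by rw [hd', mul_zero])
      have hqd' : ¬ (q : ℤ) ∣ d' := fun h ↦ hsq (by rw [hd', sq]; exact mul_dvd_mul_left _ h)
      have hlt : d'.natAbs < n := by
        have h2q : 2 ≤ q := hq.two_le
        have hab : d.natAbs = q * d'.natAbs := by rw [hd', Int.natAbs_mul, Int.natAbs_natCast]
        have hpos : 0 < d'.natAbs := Int.natAbs_pos.mpr hd'0
        have : d'.natAbs < d.natAbs := by rw [hab]; exact lt_mul_of_one_lt_left hpos hq.one_lt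
        omega
      have hcop' : IsCoprime d' (2 * A * d₀) := by
        rw [hd'] at hcop
        exact hcop.of_mul_left_right
      -- the target `W = E₀ ⊗ (e₀ d)` is additive at `q`, so `q² ∣ N(W)`
      have hD0 : e₀ * d ≠ 0 := mul_ne_zero he₀0 hd0
      have hDq : ((e₀ * d : ℤ) : ℚ) ≠ 0 := by exact_mod_cast hD0
      haveI hW : (E₀.quadraticTwist ((e₀ * d : ℤ) : ℚ)).IsElliptic := E₀.isElliptic_quadraticTwist hDq
      have h1D : (q : ℤ) ∣ e₀ * d := Dvd.dvd.mul_left ⟨d', hd'⟩ e₀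
      have h2D : ¬ (q : ℤ) ^ 2 ∣ e₀ * d := by
        rintro ⟨k, hk⟩
        have hk' : e₀ * d' = q * k := by
          have hq0Z : (q : ℤ) ≠ 0 := by exact_mod_cast hq.ne_zero
          apply mul_left_cancel₀ hq0Z
          calc (q : ℤ) * (e₀ * d') = e₀ * d := by rw [hd']; ring
            _ = (q : ℤ) ^ 2 * k := hk
            _ = q * (q * k) := by ring
        rcases hqZ.dvd_or_dvd ⟨k, hk'⟩ with h | h
        · exact hqe₀ h
        · exact hqd' h
      have hadd : Addv (E₀.quadraticTwist ((e₀ * d : ℤ) : ℚ)) q :=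
        addv_quadraticTwist_of_dvd_of_not_sq_dvd E₀ q hq2 hE hD0 h1D h2D
      have hsqN : q ^ 2 ∣ (E₀.quadraticTwist ((e₀ * d : ℤ) : ℚ)).conductorNorm ℤ :=
        sq_dvd_conductorNorm_of_not_good_of_not_mult hadd
      -- the sign of `q* = s·q` lands on `±d₀`
      set s : ℤ := (-1 : ℤ) ^ (q / 2) with hs
      have hs1 : s = 1 ∨ s = -1 := neg_one_pow_eq_or ℤ (q / 2)
      have he₁ : s * e₀ = d₀ ∨ s * e₀ = -d₀ := by
        rcases hs1 with h | h <;> rcases he₀ with rfl | rfl <;> simp [h]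
      have hqe₁ : ¬ (q : ℤ) ∣ s * e₀ * d' := by
        intro h
        rcases hqZ.dvd_or_dvd h with h' | h'
        · rcases hqZ.dvd_or_dvd h' with h'' | h''
          · rcases hs1 with h1 | h1 <;> rw [h1] at h'' <;> [skip; rw [dvd_neg] at h''] <;>
              exact hq.one_lt.ne' (by simpa using Int.eq_one_of_dvd_one (by positivity) h'')
          · exact hqe₀ h''
        · exact hqd' h'
      -- `W ⊗ χ_{q*} = E₀ ⊗ (e₀ d q*) = C • (E₀ ⊗ (s e₀ d'))`
      have hkey : ((e₀ * d : ℤ) : ℚ) * (((-1 : ℤ) ^ (q / 2) * q : ℤ) : ℚ) =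
          ((s * e₀ * d' : ℤ) : ℚ) * (q : ℚ) ^ 2 := by
        rw [hd', ← hs]; push_cast; ring
      obtain ⟨C, hC⟩ := exists_variableChange_quadraticTwist_mul_sq E₀ ((s * e₀ * d' : ℤ) : ℚ) (q : ℚ) hq0
      have hC' : C • E₀.quadraticTwist ((s * e₀ * d' : ℤ) : ℚ) =
          (E₀.quadraticTwist ((e₀ * d : ℤ) : ℚ)).quadraticTwist (((-1 : ℤ) ^ (q / 2) * q : ℤ) : ℚ) := by
        rw [quadraticTwist_quadraticTwist, hkey]; exact hC
      -- the partner is semistable at `q` …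
      have hsemi := good_or_mult_of_smul_quadraticTwist_of_not_dvd E₀ hq hq2 hE hqe₁ hC'
      -- … and certified by induction (sign absorbed into `±d₀`)
      have hQ : ClassAbsManinConstantEqOne
          ((E₀.quadraticTwist ((e₀ * d : ℤ) : ℚ)).quadraticTwist (((-1 : ℤ) ^ (q / 2) * q : ℤ) : ℚ)) := by
        rw [← hC']
        have ih' := ih d' hd'0 hlt hcop' (s * e₀) he₁
        have hm : ((s * e₀ * d' : ℤ) : ℚ) = (((s * e₀) * d' : ℤ) : ℚ) := by push_cast; ring
        rw [hm]
        exact ih'.of_isIsogenous (isIsogenous_smul _ C)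
      exact classAbsManinConstantEqOne_of_quadraticTwist_pStar hnf hq hq2 hsqN hsemi hQ

end Summit.BirchSwinnertonDyer.BirchSwinnertonDyer.Theorems.TwistFamilyManinDescent

end
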